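import Summits.BirchSwinnertonDyer.BirchSwinnertonDyer.Theorems.SmallImageMuTransferMuTransferX9OfFineRed
import Summits.BirchSwinnertonDyer.BirchSwinnertonDyer.Theorems.SmallImageMuTransferMuTransferX9NormCompatibleIntegral
import HarnessLib

/-!
# The deciding crux `MuTransferX9` (stmt-BirchSwinnertonDyer-19276) modulo F1 ALONE — F2 (Kato §13.8)
# and F3 (Poitou–Tate over `ℚ`) are tree theorems

Cell `b2b-bsdres`, unit `b2b-bsdres-x10` (= N2 class lead, GEN 40), helper for the `bsd-smallim` cell's
rung-K6 crux (`--supports stmt-BirchSwinnertonDyer-19276 --as helper`; the crux-level 1-binder reserved to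
this unit by the line lead k6-c2 g5, cell bus l.387).  HONEST FRAMING
(run/shared/lean/b2b/bsd-rank1-residual/, verbatim in every file): the goal of the cell is to DELETE the
COMBINATION-SHAPED residual classes of the Birch–Swinnerton-Dyer formula for analytic-rank `≤ 1` curves
over `ℚ` using PUBLISHED theorems only, and to TYPE the CONSTRUCTION-SHAPED remainder; this is not
"finishing BSD".  One theorem: no definition, no named fact, no `sorry`; nothing asserted about any
curve; closes NO item (the crux 19276 is unconditional and stays OPEN by design: its last hypothesis F1
is Kato's Thm. 12.5/12.6 zeta-element package, a published CONSTRUCTION fact); never summit credit.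
PARTITION (D-0054): X9 (A4; good-ordinary `p ∈ {5, 7}`, `ρ̄` irreducible ∧ ¬surjective) — helper toward
crux 19276; the same composition serves X10b∧¬Surj (A5) × `p = 3` through `X10/CoreTheoremAOddPrimeHolds`.

## What

`smallImageMuTransfer_MuTransferX9_of_fine_red (hfineZ : F1) (hred : F2) : MuTransferX9` (this unit,
p478541) with F2 = Kato §13.8 on the pin (`Kato2004.mem_pSmul_of_red_eq_zero`) PROVED IN THE TREE (cell
`bsd-smallim`): lur-a g2's weak Lemma 8.5 (2) `UniversalNorms.mem_integralH1_of_layerCores_eq_of_smul_mem`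
(`Theorems/…X9NormCompatibleIntegral`; with k6-g3 g2 p477996/p478340/p478890) through k6-g4 g2's reduction
`Kato2004.mem_pSmul_of_red_eq_zero_of_integral_of_smul_mem` (p475393/p477776), i.e. this unit's
`smallImageMuTransfer_MuTransferX9_of_fine_of_integral` (p478541) at lur-a's theorem.  No theorem of type F2
is stated here (the by-name `Kato2004.mem_pSmul_of_red_eq_zero_holds` and the closer of aside 19844 belong to
the F2 hands).  Hence

**`smallImageMuTransfer_MuTransferX9_of_fine (hfineZ : Kato2004.exists_divisibilityInputs_fineQuotient_zeta) :
Theses.SmallImageMuTransfer.MuTransferX9`** — Kato's μ-transfer on class X9 (a `p`-adic unit coefficient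
of `L_p(f, α, T)` forces `μ(X(E/ℚ_∞)) = 0`) modulo exactly ONE published named fact, Kato 2004 Thm.
12.5/12.6 + Ex. 13.3 + (14.9.3)/(17.13.1) (aside 19843 `KatoZetaFineQuotientInputs`).

References: K. Kato, Astérisque 295 (2004) Thm. 12.5, 12.6, Ex. 13.3, §13.8, Lemma 8.5, (14.9.3), §17.13
[Kato2004Asterisque]; R. Greenberg, V. Vatsal, Invent. Math. 142 (2000) Prop. 3.7 [GreenbergVatsal2000];
J. S. Milne, *Arithmetic Duality Theorems* (2006) I Thm. 4.10 [MilneADT2006].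
-/

-- the summit and its single problem are both named `BirchSwinnertonDyer` (registry layout D-0017)
set_option linter.dupNamespace false
set_option autoImplicit false

noncomputable section

open Literature.NumberTheory.EllipticCurves.Kato2004
open Summit.BirchSwinnertonDyer.BirchSwinnertonDyer.Rank1Residual

namespace Summit.BirchSwinnertonDyer.BirchSwinnertonDyer.Theorems

/-- **The deciding crux `MuTransferX9` (19276) from F1 ALONE**: `smallImageMuTransfer_MuTransferX9_of_fine_red`
composed with the tree proof of the weak Lemma 8.5 (2)
(`UniversalNorms.mem_integralH1_of_layerCores_eq_of_smul_mem`) via `…_of_fine_of_integral`.  Conclusion: the route decl BY NAME; nothing asserted.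
[cite: Kato2004Asterisque, Thm. 12.5, Thm. 12.6, §13.8, (14.9.3), §17.13] [cite: GreenbergVatsal2000, Prop. 3.7] -/
theorem smallImageMuTransfer_MuTransferX9_of_fine
    (hfineZ : exists_divisibilityInputs_fineQuotient_zeta) :
    Summit.BirchSwinnertonDyer.BirchSwinnertonDyer.Theses.SmallImageMuTransfer.MuTransferX9 :=
  smallImageMuTransfer_MuTransferX9_of_fine_of_integral hfineZ fun W _ p _ _ κ hκ z hz hpz n =>
    UniversalNorms.mem_integralH1_of_layerCores_eq_of_smul_mem W p κ hκ z hz hpz n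

end Summit.BirchSwinnertonDyer.BirchSwinnertonDyer.Theorems

end
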